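import Literature.LinearAlgebra.Matrix.LaplaceExpansion
import Mathlib.LinearAlgebra.FreeModule.PID
import Mathlib.LinearAlgebra.Matrix.Dual
import Mathlib.LinearAlgebra.Dual.Lemmas
import Mathlib.Data.Int.Associated
import HarnessLib

/-!
# Complementary minors of a primitive lattice and of its orthogonal lattice:
# `Vol_J(M) = Vol_{J'}(M^⊥)` (Bertrand 1997, §1 (c) Corollary)

Topic `Literature/LinearAlgebra/Matrix`, namespace `Literature.LinearAlgebra.Matrix`. Sequel of
`LaplaceExpansion.lean` (Jacobi's identity (0.8.4.1) `det A · det A⁻¹[αᶜ, βᶜ] = ± det A[β, α]`, the complement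
`complCard` of a `k`-element index set, the sign exponent `posSum`); lane `lit-hodgefound` (Track 2 foundations
library), seat p09 — the LATTICE statement of D. Bertrand's duality paper whose torus reading
(`cl_X(Y) = ± p^*[pt_{X/Y}]`, the complementary Plücker coordinates of `Λ_Y`) is already the tree's
`Geometry/Kaehler/ComplexTorusSubtorusClassPullbackPoint.lean` and whose symplectic version (`b` = a principal
Riemann form) is `Geometry/Kaehler/ComplexTorusComplementarySubtorusClassDuality.lean`.

## The printed statement

D. Bertrand, *Duality on tori and multiplicative dependence relations*, J. Austral. Math. Soc. (Series A) **62**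
(1997) 198–216 [cite: Bertrand1997DualityTori], held copy `paper:doi-10-1017-s1446788700000768`, §1 (c)
"Complementary minors" (p0005 L38 – p0006 L8), verbatim: "Suppose now that `(V, b)` is `ℝⁿ`, endowed with its
standard scalar product, and that `L` is the unimodular lattice `ℤⁿ`. For any subset `J` of the set `{1, …, n}`,
of cardinality, say, `r`, denote by `p_J` the orthogonal projection of `ℝⁿ` to its `r`-dimensional face `ℝ^J`.
Given a subgroup `M` of `L` of rank `r`, we set: `Vol_J(M) = Vol(p_J(M))` = covolume of `p_J(M)` in `ℝ^J` if
`p_J(M)` has rank `r`, `Vol_J(M) = 0` if `rk(p_J(M)) < r`. Thus, `Vol_J(M)` is in both cases the absolute value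
of the `J × {1, …, r}`-minor of any `(n × r)`-matrix expressing a base of `M` over `ℤ` in the canonical basis of
`ℝⁿ`. […] COROLLARY. Let `M` be a primitive subgroup of rank `r` of `ℤⁿ`, let `M^⊥` be its orthogonal complement
with respect to the standard scalar product on `ℝⁿ`, and let `J ⊔ J'` be a partition of `{1, …, n}` in two
subsets of cardinality `r`, `n − r`. Then `Vol_J(M) = Vol_{J'}(M^⊥)`." (§1 (b), p0003 L36: "`M` is a primitive
subgroup of `L`" iff "`M` coincides with the intersection of `L` with `W`" iff "`M` is a direct factor in `L`";
proof of Prop. 1, p0004 L26: "`(M^⊥)^⊥ := L ∩ (W^⊥)^⊥ = L ∩ W = M`".)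

Bertrand deduces the Corollary from his Prop. 1 by a deformation argument (the twisted scalar products `b_z`).
The proof formalised here is the classical one through an ADAPTED UNIMODULAR BASIS: a primitive `M` is spanned by
`r` columns `F` of some `A ∈ GL_n(ℤ)` (Smith normal form); then `M^⊥` is spanned by the complementary rows `Fᶜ`
of `A⁻¹`, and Jacobi's identity on the minors of the inverse matrix (Horn–Johnson (0.8.4.1), tree
`det_mul_det_inv_submatrix_compl`) reads `det A · det A⁻¹[Fᶜ, J'] = ± det A[J, F]`, i.e. `Vol_{J'}(M^⊥) = Vol_J(M)`
for these bases — any other bases change all `r`-minors by the same unit.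

## Rendering and contents (one definition with body, theorems; NO named fact)

Bases of sub-lattices are written as ROW families `u : κ → (ι → R)` (Bertrand's `(n × r)`-matrix is the
transpose; `Vol_J` is the absolute value of the determinant of the ROWS of `Matrix.of u` restricted to the COLUMNS
`J`, `det ((Matrix.of u).submatrix id J)`, equal to Bertrand's `J × {1, …, r}`-minor by `det_transpose`); index
sets `J` are `Set.powersetCard ι r` read increasingly through `ofFinEmbEquiv.symm`, complements through
`complCard` (as in `LaplaceExpansion.lean`).

* §1 `dotAnnihilator N = N^⊥ = {y | ∀ x ∈ N, y ⬝ᵥ x = 0}` for a submodule `N ≤ R^ι` over any commutative ring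
  (Mathlib's `Submodule.dualAnnihilator` pulled back along `dotProductEquiv`): `mem_dotAnnihilator`,
  `dotAnnihilator_anti`, `le_dotAnnihilator_dotAnnihilator`, `smul_mem_dotAnnihilator_iff` (`N^⊥` is primitive
  over a domain).
* §2 ADAPTED PAIRS: for `A A' = 1` (private: `y = Σ_l (y · A_{·l}) A'_{l·}`, `A'_{g·} · A_{·f} = δ_{gf}`) and
  any set `S` of indices,
  **`dotAnnihilator_span_cols_eq_span_rows`**: `(span of the columns S of A)^⊥ = span of the rows Sᶜ of A'`,
  `dotAnnihilator_span_rows_eq_span_cols` (the same for the inverse pair `(ᵗA', ᵗA)`) and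
  **`dotAnnihilator_dotAnnihilator_span_cols`**: `((span cols S)^⊥)^⊥ = span cols S` ("`(M^⊥)^⊥ = M`").
* §3 CHANGE OF BASIS: `det_submatrix_of_eq_det_mul` (if `u = ᵗC v` then every maximal minor of `u` is `det C`
  times that of `v`), `isUnit_det_repr_of_span` (the matrix of a spanning family of the right size in a basis is
  invertible), `associated_det_submatrix_basis` (two bases / a basis and a spanning family of a sub-lattice have
  ASSOCIATED maximal minors).
* §4 **`det_mul_det_submatrix_inv_rows_eq`** — the SIGNED Corollary for an adapted unimodular basis, over any
  commutative ring: `det A · det (rows Fᶜ of A⁻¹)[·, Jᶜ] = (−1)^{p(F)+p(J)} det (cols F of A)[J, ·]`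
  (Jacobi (0.8.4.1) with `α = F`, `β = J`).
* §5 PRIMITIVE SUB-LATTICES over a principal ideal domain `R` (`ℤ` in the source):
  `exists_adapted_basis_of_isPrimitive` (Smith normal form + primitivity: `M` is spanned by `r` vectors of a
  basis of `R^ι`; private: the matrix of a basis of `R^ι` is unimodular), **`dotAnnihilator_dotAnnihilator_of_isPrimitive`** (`(M^⊥)^⊥ = M`),
  `exists_basis_dotAnnihilator` (`M^⊥` is free of rank `n − r`: a basis indexed by `Fin (card ι − r)` —
  non-vacuity of the Corollary's `M^⊥`-side), **`associated_det_minor_dotAnnihilator`** (for ANY bases of `M`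
  and `M^⊥` and every `r`-set `J`, the `J`-minor of `M` and the `Jᶜ`-minor of `M^⊥` are associated) and
  **`natAbs_det_minor_eq_natAbs_det_minor_dotAnnihilator`** — the Corollary AS PRINTED over `ℤ`:
  `|J-minor of a basis of M| = |J'-minor of a basis of M^⊥|`.

## References

* [Bertrand1997DualityTori] D. Bertrand, *Duality on tori and multiplicative dependence relations*, J. Austral.
  Math. Soc. (Series A) 62 (1997), §1 (b) Prop. 1 (p. 201) and §1 (c) Corollary (p. 203).
* [HornJohnson2013] R. A. Horn, C. R. Johnson, *Matrix Analysis*, 2nd ed., CUP (2013), §0.8.4 (0.8.4.1)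
  (Jacobi's identity — the tree's `LaplaceExpansion.det_mul_det_inv_submatrix_compl`).
-/

open Matrix Set Set.powersetCard Finset Module

namespace Literature.LinearAlgebra.Matrix

universe u v

/-! ## §1 The orthogonal lattice `N^⊥` for the standard scalar product -/

section Annihilator

variable {R : Type u} [CommRing R] {ι : Type v} [Fintype ι] [DecidableEq ι]

/-- **The orthogonal complement `N^⊥ = {y ∈ R^ι | y · x = 0 for all x ∈ N}` of a submodule `N ≤ R^ι` for the
standard scalar product** (Bertrand's `M^⊥`, "its orthogonal complement with respect to the standard scalar
product"; for `R = ℤ` this is the lattice `ℤⁿ ∩ W^⊥`). Mathlib's dual annihilator read through the dot-product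
duality `dotProductEquiv : R^ι ≃ (R^ι)^*`. [cite: Bertrand1997DualityTori, §1 (c) Corollary (p. 203)] -/
def dotAnnihilator (N : Submodule R (ι → R)) : Submodule R (ι → R) :=
  N.dualAnnihilator.comap (dotProductEquiv R ι).toLinearMap

/-- Membership in `N^⊥`: `y ∈ N^⊥ ↔ ∀ x ∈ N, y ⬝ᵥ x = 0`. [cite: Bertrand1997DualityTori, §1 (c) (p. 203)] -/
theorem mem_dotAnnihilator {N : Submodule R (ι → R)} {y : ι → R} :
    y ∈ dotAnnihilator N ↔ ∀ x ∈ N, y ⬝ᵥ x = 0 := by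
  simp [dotAnnihilator, Submodule.mem_dualAnnihilator]

/-- Membership in the orthogonal lattice of a span: it suffices to be orthogonal to the generators.
[cite: Bertrand1997DualityTori, §1 (c) (p. 203)] -/
theorem mem_dotAnnihilator_span_iff {s : Set (ι → R)} {y : ι → R} :
    y ∈ dotAnnihilator (Submodule.span R s) ↔ ∀ x ∈ s, y ⬝ᵥ x = 0 := by
  rw [mem_dotAnnihilator]
  refine ⟨fun h x hx ↦ h x (Submodule.subset_span hx), fun h x hx ↦ ?_⟩
  induction hx using Submodule.span_induction with
  | mem x hx => exact h x hx
  | zero => exact dotProduct_zero y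
  | add x x' _ _ hx hx' => rw [dotProduct_add, hx, hx', add_zero]
  | smul c x _ hx => rw [dotProduct_smul, hx, smul_zero]

/-- `N ↦ N^⊥` is antitone. [cite: Bertrand1997DualityTori, §1 (a) (p. 200: "If `N` is a lattice containing `M`, its dual `N^*` lies in `M^*`")] -/
theorem dotAnnihilator_anti {N N' : Submodule R (ι → R)} (h : N ≤ N') : dotAnnihilator N' ≤ dotAnnihilator N :=
  fun _ hy ↦ mem_dotAnnihilator.2 fun x hx ↦ mem_dotAnnihilator.1 hy x (h hx)

/-- `N ≤ (N^⊥)^⊥` (the scalar product is symmetric). [cite: Bertrand1997DualityTori, §1 (b) (proof of Prop. 1, p. 201: "`(M^⊥)^⊥ … = M`")] -/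
theorem le_dotAnnihilator_dotAnnihilator (N : Submodule R (ι → R)) : N ≤ dotAnnihilator (dotAnnihilator N) :=
  fun _ hx ↦ mem_dotAnnihilator.2 fun _ hy ↦ by rw [dotProduct_comm]; exact mem_dotAnnihilator.1 hy _ hx

/-- **`N^⊥` is primitive** (over a domain): `c • y ∈ N^⊥` with `c ≠ 0` forces `y ∈ N^⊥`.
[cite: Bertrand1997DualityTori, §1 (b) Prop. 1 (p. 200: "`M^⊥` the primitive subgroup of `L` cut out by … `W^⊥`")] -/
theorem smul_mem_dotAnnihilator_iff [IsDomain R] {N : Submodule R (ι → R)} {c : R} (hc : c ≠ 0) {y : ι → R} :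
    c • y ∈ dotAnnihilator N ↔ y ∈ dotAnnihilator N := by
  simp only [mem_dotAnnihilator, smul_dotProduct, smul_eq_mul, mul_eq_zero, hc, false_or]

end Annihilator

/-! ## §2 Adapted unimodular pairs: `(span cols_S A)^⊥ = span rows_{Sᶜ} A'` for `A A' = 1` -/

section Adapted

variable {R : Type u} [CommRing R] {ι : Type v} [Fintype ι] [DecidableEq ι]

/-- Reconstruction of a vector from its scalar products with the columns of `A` and the rows of a right inverse
`A'`: `y = Σ_l (y · A_{·l}) A'_{l·}`. [folklore] -/
private theorem sum_dotProduct_col_smul_row {A A' : Matrix ι ι R} (h : A * A' = 1) (y : ι → R) :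
    ∑ l, (y ⬝ᵥ Aᵀ l) • A' l = y := by
  funext i
  have h2 : (∑ l, (y ⬝ᵥ Aᵀ l) • A' l) i = ((y ᵥ* A) ᵥ* A') i := by
    simp only [Finset.sum_apply, Pi.smul_apply, smul_eq_mul, Matrix.vecMul, dotProduct, transpose_apply]
  rw [h2, Matrix.vecMul_vecMul, h, Matrix.vecMul_one]

/-- A row of a left inverse is orthogonal to the other columns: `A'_{g·} · A_{·f} = δ_{gf}`. [folklore] -/
private theorem row_dotProduct_col {A A' : Matrix ι ι R} (h : A' * A = 1) (g f : ι) :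
    A' g ⬝ᵥ Aᵀ f = if g = f then 1 else 0 := by
  have := congrFun (congrFun h g) f
  rw [Matrix.mul_apply, Matrix.one_apply] at this
  simpa only [dotProduct, transpose_apply] using this

/-- **The orthogonal lattice of the span of some columns of a unimodular matrix is the span of the complementary
rows of its inverse**: for `A A' = 1` and any index set `S`,
`(span {A_{·l} : l ∈ S})^⊥ = span {A'_{l·} : l ∉ S}` (Bertrand, proof of Prop. 1: "`p(L^*)` coincides with
`(W^⊥ ∩ L)^* = (M^⊥)^*`"; here in the unimodular case through the dual basis). [cite: Bertrand1997DualityTori, §1 (b) Prop. 1 proof (p. 201) and §1 (c) Corollary (p. 203)] -/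
theorem dotAnnihilator_span_cols_eq_span_rows {A A' : Matrix ι ι R} (h : A * A' = 1) (S : Set ι) :
    dotAnnihilator (Submodule.span R ((fun l ↦ Aᵀ l) '' S)) = Submodule.span R ((fun l ↦ A' l) '' Sᶜ) := by
  have h' : A' * A = 1 := mul_eq_one_comm.1 h
  refine le_antisymm (fun y hy ↦ ?_) (Submodule.span_le.2 ?_)
  · -- `y = Σ_{l ∉ S} (y · A_{·l}) A'_{l·}`
    rw [mem_dotAnnihilator_span_iff] at hy
    rw [← sum_dotProduct_col_smul_row h y]
    refine Submodule.sum_mem _ fun l _ ↦ ?_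
    by_cases hl : l ∈ S
    · rw [hy (Aᵀ l) ⟨l, hl, rfl⟩, zero_smul]
      exact Submodule.zero_mem _
    · exact Submodule.smul_mem _ _ (Submodule.subset_span ⟨l, hl, rfl⟩)
  · rintro _ ⟨g, hg, rfl⟩
    refine (mem_dotAnnihilator_span_iff).2 ?_
    rintro _ ⟨f, hf, rfl⟩
    rw [row_dotProduct_col h', if_neg]
    rintro rfl
    exact hg hf

/-- **`(M^⊥)^⊥ = M` for the span `M` of some columns of a unimodular matrix** (the pair `(ᵗA', ᵗA)` is again
inverse: the orthogonal lattice of the rows `Sᶜ` of `A'` is the span of the columns `S` of `A`).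
[cite: Bertrand1997DualityTori, §1 (b) Prop. 1 proof (p. 201: "`(M^⊥)^⊥ := L ∩ (W^⊥)^⊥ = L ∩ W = M`")] -/
theorem dotAnnihilator_span_rows_eq_span_cols {A A' : Matrix ι ι R} (h : A * A' = 1) (S : Set ι) :
    dotAnnihilator (Submodule.span R ((fun l ↦ A' l) '' Sᶜ)) = Submodule.span R ((fun l ↦ Aᵀ l) '' S) := by
  have hT : A'ᵀ * Aᵀ = 1 := by rw [← transpose_mul, h, transpose_one]
  have := dotAnnihilator_span_cols_eq_span_rows hT Sᶜ
  rwa [transpose_transpose, compl_compl] at this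

/-- `((span cols_S A)^⊥)^⊥ = span cols_S A`. [cite: Bertrand1997DualityTori, §1 (b) Prop. 1 proof (p. 201)] -/
theorem dotAnnihilator_dotAnnihilator_span_cols {A A' : Matrix ι ι R} (h : A * A' = 1) (S : Set ι) :
    dotAnnihilator (dotAnnihilator (Submodule.span R ((fun l ↦ Aᵀ l) '' S))) =
      Submodule.span R ((fun l ↦ Aᵀ l) '' S) := by
  rw [dotAnnihilator_span_cols_eq_span_rows h, dotAnnihilator_span_rows_eq_span_cols h]

end Adapted

/-! ## §3 Maximal minors under a change of basis -/

section ChangeOfBasis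

variable {R : Type u} [CommRing R] {ι : Type v} {κ : Type*} [Fintype κ] [DecidableEq κ]

/-- **Maximal minors transform by `det C` under a change of generators `u = ᵗC v`**: if `u i = Σ_k C k i • v k`
then for every choice `e` of `|κ|` coordinates, `det (u restricted to e) = det C · det (v restricted to e)`
(Bertrand: "`Vol_J(M)` is … the minor of ANY matrix expressing a base of `M`" — well defined up to the unit
`det C`). [cite: Bertrand1997DualityTori, §1 (c) (p. 202: "any `(n × r)`-matrix expressing a base of `M`")] -/
theorem det_submatrix_of_eq_det_mul {u v : κ → ι → R} {C : Matrix κ κ R} (hC : ∀ i, u i = ∑ k, C k i • v k)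
    (e : κ → ι) : ((Matrix.of u).submatrix id e).det = C.det * ((Matrix.of v).submatrix id e).det := by
  have hM : (Matrix.of u).submatrix id e = Cᵀ * (Matrix.of v).submatrix id e := by
    ext i a
    simp only [submatrix_apply, id_eq, of_apply, Matrix.mul_apply, transpose_apply, hC i, Finset.sum_apply,
      Pi.smul_apply, smul_eq_mul]
  rw [hM, det_mul, det_transpose]

/-- **The coordinate matrix of a spanning family of the right size in a basis is invertible**: for a basis `b`
of `N ≤ R^ι` indexed by `κ` and a family `u : κ → N` spanning `N`, the matrix `C k i = (b.repr (u i)) k`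
(`u = ᵗC b`) has unit determinant. [cite: Bertrand1997DualityTori, §1 (c) (p. 202: "any … base of `M` over `ℤ`")] -/
theorem isUnit_det_repr_of_span {N : Submodule R (ι → R)} (b : Basis κ R N) {u : κ → ι → R}
    (hu : ∀ i, u i ∈ N) (hsp : ∀ x ∈ N, x ∈ Submodule.span R (Set.range u)) :
    IsUnit (Matrix.of fun k i ↦ b.repr ⟨u i, hu i⟩ k).det := by
  classical
  -- `b k = Σ_i d k i • u i`
  have hD : ∀ k, ∃ d : κ → R, ∑ i, d i • u i = (b k : ι → R) := fun k ↦
    (Submodule.mem_span_range_iff_exists_fun R).1 (hsp _ (b k).2)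
  choose d hd using hD
  set C : Matrix κ κ R := Matrix.of fun k i ↦ b.repr ⟨u i, hu i⟩ k with hCdef
  let D : Matrix κ κ R := Matrix.of fun i k ↦ d k i
  -- `u i = Σ_k C k i • b k`, in `N` and in `R^ι`
  have hCu : ∀ i, (⟨u i, hu i⟩ : N) = ∑ k, C k i • b k := fun i ↦ (b.sum_repr ⟨u i, hu i⟩).symm
  have hCu' : ∀ i, u i = ∑ k', C k' i • ((b k' : N) : ι → R) := fun i ↦ by
    have := congrArg (fun x : N ↦ (x : ι → R)) (hCu i)
    simpa only [Submodule.coe_sum, Submodule.coe_smul] using this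
  -- `b k = Σ_{k'} (C D) k' k • b k'`
  have key : ∀ k, (b k : N) = ∑ k', (fun x ↦ (C * D) x k) k' • b k' := fun k ↦ by
    apply Subtype.ext
    rw [Submodule.coe_sum]
    simp only [Submodule.coe_smul]
    calc ((b k : N) : ι → R) = ∑ i, D i k • u i := (hd k).symm
      _ = ∑ i, D i k • ∑ k', C k' i • ((b k' : N) : ι → R) :=
          Finset.sum_congr rfl fun i _ ↦ by rw [← hCu' i]
      _ = ∑ k', (C * D) k' k • ((b k' : N) : ι → R) := by
          simp only [Finset.smul_sum, smul_smul, Matrix.mul_apply, Finset.sum_smul]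
          rw [Finset.sum_comm]
          exact Finset.sum_congr rfl fun k' _ ↦ Finset.sum_congr rfl fun i _ ↦ by rw [mul_comm]
  -- hence `C D = 1`
  have hCD : C * D = 1 := by
    ext k' k
    have h := congrArg (fun x : N ↦ (b.repr x : κ → R) k') (key k)
    simp only [b.repr_self, b.repr_sum_self] at h
    rw [Matrix.one_apply, ← h, Finsupp.single_apply]
    rcases eq_or_ne k k' with rfl | hk
    · rfl
    · rw [if_neg hk, if_neg (Ne.symm hk)]
  exact Matrix.isUnit_det_of_right_inverse hCD

/-- **Two bases — or a basis and a spanning family of the right size — of a sub-lattice have ASSOCIATED maximal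
minors** (they differ by the unit `det C` of the change of basis). [cite: Bertrand1997DualityTori, §1 (c) (p. 202: "`Vol_J(M)` is … the absolute value of the minor of any … base of `M`")] -/
theorem associated_det_submatrix_basis {N : Submodule R (ι → R)} (b : Basis κ R N) {u : κ → ι → R}
    (hu : ∀ i, u i ∈ N) (hsp : ∀ x ∈ N, x ∈ Submodule.span R (Set.range u)) (e : κ → ι) :
    Associated ((Matrix.of u).submatrix id e).det ((Matrix.of fun k ↦ (b k : ι → R)).submatrix id e).det := by
  have hC : ∀ i, u i = ∑ k, (Matrix.of fun k i ↦ b.repr ⟨u i, hu i⟩ k) k i • (b k : ι → R) := fun i ↦ by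
    have := congrArg (fun x : N ↦ (x : ι → R)) (b.sum_repr ⟨u i, hu i⟩)
    simpa only [Submodule.coe_sum, Submodule.coe_smul, of_apply] using this.symm
  rw [det_submatrix_of_eq_det_mul hC e]
  obtain ⟨c, hc⟩ := isUnit_det_repr_of_span b hu hsp
  exact ⟨c⁻¹, by rw [← hc, mul_comm, ← mul_assoc, Units.inv_mul, one_mul]⟩

end ChangeOfBasis

/-! ## §4 The signed Corollary for an adapted unimodular basis (Jacobi's identity) -/

section Signed

variable {R : Type u} [CommRing R] {ι : Type v} [LinearOrder ι] [Fintype ι] {r : ℕ}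

/-- **Complementary minors of a unimodular matrix and of its inverse (the signed Corollary for adapted bases)**:
for `det A` a unit, an `r`-set `F` of columns and an `r`-set `J` of rows,
`det A · det ((rows Fᶜ of A⁻¹) on the coordinates Jᶜ) = (−1)^{p(F)+p(J)} · det ((columns F of A) on the
coordinates J)` — Jacobi's identity (0.8.4.1) with `α = F`, `β = J`. With `M = span cols_F A` and
`M^⊥ = span rows_{Fᶜ} A⁻¹` (§2) this is `Vol_{Jᶜ}(M^⊥) = Vol_J(M)` for these bases, with its sign.
[cite: Bertrand1997DualityTori, §1 (c) Corollary (p. 203)] [cite: HornJohnson2013, §0.8.4 (0.8.4.1)] -/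
theorem det_mul_det_submatrix_inv_rows_eq (A : Matrix ι ι R) (hA : IsUnit A.det) (F J : Set.powersetCard ι r) :
    A.det * ((Matrix.of fun g ↦ A⁻¹ (ofFinEmbEquiv.symm (complCard F) g)).submatrix id
        (ofFinEmbEquiv.symm (complCard J))).det =
      (-1 : R) ^ (posSum (F : Finset ι) + posSum (J : Finset ι)) *
        ((Matrix.of fun c ↦ Aᵀ (ofFinEmbEquiv.symm F c)).submatrix id (ofFinEmbEquiv.symm J)).det := by
  have h1 : (Matrix.of fun g ↦ A⁻¹ (ofFinEmbEquiv.symm (complCard F) g)).submatrix id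
      (ofFinEmbEquiv.symm (complCard J)) =
      A⁻¹.submatrix (ofFinEmbEquiv.symm (complCard F)) (ofFinEmbEquiv.symm (complCard J)) := rfl
  have h2 : (Matrix.of fun c ↦ Aᵀ (ofFinEmbEquiv.symm F c)).submatrix id (ofFinEmbEquiv.symm J) =
      (A.submatrix (ofFinEmbEquiv.symm J) (ofFinEmbEquiv.symm F))ᵀ := rfl
  rw [h1, h2, det_transpose]
  exact det_mul_det_inv_submatrix_compl A hA F J

end Signed

/-! ## §5 Primitive sub-lattices over a principal ideal domain: `(M^⊥)^⊥ = M` and `Vol_J(M) = Vol_{J'}(M^⊥)` -/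

/-- Units bookkeeping: `a y = s x` with `a` a unit and `s² = 1` makes `x` and `y` associated. [folklore] -/
private theorem associated_of_unit_mul_eq {R : Type u} [CommRing R] {a s x y : R} (ha : IsUnit a)
    (hs : s * s = 1) (h : a * y = s * x) : Associated x y := by
  obtain ⟨d, rfl⟩ := ha
  refine ⟨d⁻¹ * Units.mkOfMulEqOne s s hs, ?_⟩
  rw [Units.val_mul, Units.val_mkOfMulEqOne]
  calc x * (↑d⁻¹ * s) = ↑d⁻¹ * (s * x) := by ring
    _ = ↑d⁻¹ * (↑d * y) := by rw [h]
    _ = y := by rw [← mul_assoc, Units.inv_mul, one_mul]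

section Primitive

variable {R : Type u} [CommRing R] [IsDomain R] [IsPrincipalIdealRing R] {ι : Type v} [Fintype ι] {r : ℕ}

section Unordered

variable [DecidableEq ι]

omit [DecidableEq ι] in
/-- **A primitive sub-lattice is spanned by part of a basis of `R^ι`** ("`M` is a direct factor in `L`"): if
`M ≤ R^ι` is primitive (`c • x ∈ M`, `c ≠ 0 ⇒ x ∈ M`) with a basis indexed by `Fin r`, there is a basis `β` of
`R^ι` and an `r`-set `F` of indices with `M = span {β l : l ∈ F}`. From Mathlib's Smith normal form
`bN i = a i • β (f i)` over the principal ideal domain `R`: primitivity forces `β (f i) ∈ M`.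
[cite: Bertrand1997DualityTori, §1 (b) (p. 200: "`M` is a direct factor in `L` (… in which case we say that `M` is a primitive subgroup of `L`)")] -/
theorem exists_adapted_basis_of_isPrimitive (M : Submodule R (ι → R))
    (hM : ∀ (c : R) (x : ι → R), c ≠ 0 → c • x ∈ M → x ∈ M) (b : Basis (Fin r) R M) :
    ∃ (β : Basis ι R (ι → R)) (f : Fin r ↪ ι),
      (∀ i, β (f i) ∈ M) ∧ M = Submodule.span R (Set.range fun i ↦ β (f i)) := by
  obtain ⟨n, snf⟩ := M.smithNormalForm (Pi.basisFun R ι)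
  obtain rfl : n = r := Fin.equiv_iff_eq.1 ⟨snf.bN.indexEquiv b⟩
  have ha : ∀ i, snf.a i ≠ 0 := fun i h0 ↦ by
    have := snf.snf i
    rw [h0, zero_smul, Submodule.coe_eq_zero] at this
    exact snf.bN.ne_zero i this
  have hmem : ∀ i, snf.bM (snf.f i) ∈ M := fun i ↦
    hM (snf.a i) _ (ha i) (by rw [← snf.snf i]; exact (snf.bN i).2)
  refine ⟨snf.bM, snf.f, hmem, le_antisymm (fun x hx ↦ ?_) (Submodule.span_le.2 ?_)⟩
  · have hx' : x = ∑ i, (snf.bN.repr ⟨x, hx⟩ i * snf.a i) • snf.bM (snf.f i) := by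
      have := congrArg (fun y : M ↦ (y : ι → R)) (snf.bN.sum_repr ⟨x, hx⟩)
      simp only [Submodule.coe_sum, Submodule.coe_smul, snf.snf, smul_smul] at this
      exact this.symm
    rw [hx']
    exact Submodule.sum_mem _ fun i _ ↦ Submodule.smul_mem _ _ (Submodule.subset_span ⟨i, rfl⟩)
  · rintro _ ⟨i, rfl⟩
    exact hmem i

omit [IsDomain R] [IsPrincipalIdealRing R] in
/-- The matrix `A = (β_l)_{columns}` of a basis `β` of `R^ι` (`A j l = β l j`) is unimodular. [folklore] -/
private theorem isUnit_det_transpose_of_basis (β : Basis ι R (ι → R)) :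
    IsUnit (Matrix.of fun l ↦ (β l : ι → R))ᵀ.det := by
  have hA : (Matrix.of fun l ↦ (β l : ι → R))ᵀ = (Pi.basisFun R ι).toMatrix β := by
    ext j l
    rw [transpose_apply, of_apply, Basis.toMatrix_apply, Pi.basisFun_repr]
  rw [hA]
  exact Matrix.isUnit_det_of_right_inverse (Basis.toMatrix_mul_toMatrix_flip _ _)

/-- **`(M^⊥)^⊥ = M` for a primitive sub-lattice `M` of `R^ι`** (`R` a principal ideal domain; Bertrand:
"`(M^⊥)^⊥ := L ∩ (W^⊥)^⊥ = L ∩ W = M`" because `M` is primitive).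
[cite: Bertrand1997DualityTori, §1 (b) Prop. 1 proof (p. 201)] -/
theorem dotAnnihilator_dotAnnihilator_of_isPrimitive (M : Submodule R (ι → R))
    (hM : ∀ (c : R) (x : ι → R), c ≠ 0 → c • x ∈ M → x ∈ M) (b : Basis (Fin r) R M) :
    dotAnnihilator (dotAnnihilator M) = M := by
  obtain ⟨β, f, -, hspan⟩ := exists_adapted_basis_of_isPrimitive M hM b
  set A : Matrix ι ι R := (Matrix.of fun l ↦ (β l : ι → R))ᵀ with hAdef
  have hA : IsUnit A.det := isUnit_det_transpose_of_basis β
  have hcols : Submodule.span R ((fun l ↦ Aᵀ l) '' Set.range f) = M := by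
    rw [hspan, ← Set.range_comp]
    rfl
  rw [← hcols]
  exact dotAnnihilator_dotAnnihilator_span_cols (mul_nonsing_inv A hA) _

end Unordered

section Ordered

variable [LinearOrder ι]

omit [Fintype ι] in
/-- The increasing enumeration of an `r`-set has that set as its range. [folklore] -/
private theorem range_ofFinEmbEquiv_symm (s : Set.powersetCard ι r) :
    Set.range (ofFinEmbEquiv.symm s) = (s : Set ι) :=
  Set.ext fun i ↦ mem_range_ofFinEmbEquiv_symm_iff_mem s i

/-- The increasing enumeration of `complCard s` has range `sᶜ`. [folklore] -/
private theorem range_ofFinEmbEquiv_symm_complCard (s : Set.powersetCard ι r) :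
    Set.range (ofFinEmbEquiv.symm (complCard s)) = (s : Set ι)ᶜ := by
  ext i
  rw [mem_range_ofFinEmbEquiv_symm_iff_mem, Set.mem_compl_iff]
  exact mem_complCard

/-- **The common core of the Corollary**: for a primitive `M` with a basis indexed by `Fin r` there are a
unimodular `A`, an `r`-set `F`, the column family `u` of `A` on `F` SPANNING `M` and the row family `w` of `A⁻¹`
on `Fᶜ` SPANNING `M^⊥` — so that §4 applies to `(u, w)` and §3 moves the result to arbitrary bases. [folklore] -/
private theorem exists_adapted_pair (M : Submodule R (ι → R))
    (hM : ∀ (c : R) (x : ι → R), c ≠ 0 → c • x ∈ M → x ∈ M) (b : Basis (Fin r) R M) :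
    ∃ (A : Matrix ι ι R) (F : Set.powersetCard ι r), IsUnit A.det ∧
      (∀ c, Aᵀ (ofFinEmbEquiv.symm F c) ∈ M) ∧
      (∀ x ∈ M, x ∈ Submodule.span R (Set.range fun c ↦ Aᵀ (ofFinEmbEquiv.symm F c))) ∧
      (∀ g, A⁻¹ (ofFinEmbEquiv.symm (complCard F) g) ∈ dotAnnihilator M) ∧
      (∀ y ∈ dotAnnihilator M,
        y ∈ Submodule.span R (Set.range fun g ↦ A⁻¹ (ofFinEmbEquiv.symm (complCard F) g))) := by
  obtain ⟨β, f, -, hspan⟩ := exists_adapted_basis_of_isPrimitive M hM b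
  set A : Matrix ι ι R := (Matrix.of fun l ↦ (β l : ι → R))ᵀ with hAdef
  have hA : IsUnit A.det := isUnit_det_transpose_of_basis β
  let F : Set.powersetCard ι r := ofFinEmb r ι f
  have hF : (F : Set ι) = Set.range f := coe_ofFinEmb r ι f
  -- `M = span cols_F A`, `M^⊥ = span rows_{Fᶜ} A⁻¹`
  have hcols : Submodule.span R ((fun l ↦ Aᵀ l) '' (F : Set ι)) = M := by
    rw [hspan, hF, ← Set.range_comp]
    rfl
  have hrows : dotAnnihilator M = Submodule.span R ((fun l ↦ A⁻¹ l) '' (F : Set ι)ᶜ) := by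
    rw [← hcols]
    exact dotAnnihilator_span_cols_eq_span_rows (mul_nonsing_inv A hA) _
  have hu : Set.range (fun c ↦ Aᵀ (ofFinEmbEquiv.symm F c)) = (fun l ↦ Aᵀ l) '' (F : Set ι) := by
    rw [← range_ofFinEmbEquiv_symm F, ← Set.range_comp]
    rfl
  have hw : Set.range (fun g ↦ A⁻¹ (ofFinEmbEquiv.symm (complCard F) g)) = (fun l ↦ A⁻¹ l) '' (F : Set ι)ᶜ := by
    rw [← range_ofFinEmbEquiv_symm_complCard F, ← Set.range_comp]
    rfl
  refine ⟨A, F, hA, fun c ↦ ?_, fun x hx ↦ ?_, fun g ↦ ?_, fun y hy ↦ ?_⟩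
  · rw [← hcols]
    exact Submodule.subset_span ⟨_, (mem_range_ofFinEmbEquiv_symm_iff_mem F _).1 ⟨c, rfl⟩, rfl⟩
  · rwa [hu, hcols]
  · rw [hrows]
    refine Submodule.subset_span ⟨_, ?_, rfl⟩
    rw [Set.mem_compl_iff]
    exact mem_complCard.1 ((mem_range_ofFinEmbEquiv_symm_iff_mem (complCard F) _).1 ⟨g, rfl⟩)
  · rwa [hw, ← hrows]

/-- **`M^⊥` is a free lattice of rank `n − r`**: for a primitive `M ≤ R^ι` with a basis indexed by `Fin r`,
`M^⊥` has a basis indexed by `Fin (card ι − r)` (the rows `Fᶜ` of `A⁻¹` for an adapted unimodular `A`) — the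
index type of the `M^⊥`-side of the Corollary is inhabited. [cite: Bertrand1997DualityTori, §1 (c) Corollary (p. 203: "`J ⊔ J'` … of cardinality `r`, `n − r`"; `rk(M^⊥) = n − r`)] -/
theorem exists_basis_dotAnnihilator (M : Submodule R (ι → R))
    (hM : ∀ (c : R) (x : ι → R), c ≠ 0 → c • x ∈ M → x ∈ M) (b : Basis (Fin r) R M) :
    Nonempty (Basis (Fin (Fintype.card ι - r)) R (dotAnnihilator M)) := by
  obtain ⟨A, F, hA, -, -, hw, hwsp⟩ := exists_adapted_pair M hM b
  set w : Fin (Fintype.card ι - r) → ι → R := fun g ↦ A⁻¹ (ofFinEmbEquiv.symm (complCard F) g) with hwdef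
  -- `w` is linearly independent: rows of the invertible `A⁻¹` along an injective enumeration
  have hAinv : A⁻¹.det ≠ 0 := by
    obtain ⟨c, hc⟩ := (A.isUnit_nonsing_inv_det_iff).2 hA
    rw [← hc]; exact c.ne_zero
  have hli : LinearIndependent R w :=
    (Matrix.linearIndependent_rows_of_det_ne_zero hAinv).comp _ (ofFinEmbEquiv.symm (complCard F)).injective
  let v : Fin (Fintype.card ι - r) → dotAnnihilator M := fun g ↦ ⟨w g, hw g⟩
  have hv : LinearIndependent R v := LinearIndependent.of_comp (dotAnnihilator M).subtype hli
  have hsp : ⊤ ≤ Submodule.span R (Set.range v) := by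
    rintro ⟨y, hy⟩ -
    have hy' : y ∈ Submodule.span R (Set.range w) := hwsp y hy
    have hrange : Set.range w = (dotAnnihilator M).subtype '' Set.range v := by
      rw [← Set.range_comp]; rfl
    rw [hrange, ← Submodule.map_span] at hy'
    obtain ⟨z, hz, hzy⟩ := hy'
    have : z = ⟨y, hy⟩ := Subtype.ext hzy
    rwa [← this]
  exact ⟨Basis.mk hv hsp⟩

/-- **The Corollary up to units, over a principal ideal domain**: for a primitive sub-lattice `M ≤ R^ι` of rank
`r`, ANY bases `b` of `M` and `b'` of `M^⊥`, and every `r`-set `J` of coordinates, the `J`-minor of `b` and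
the `Jᶜ`-minor of `b'` are ASSOCIATED (equal up to a unit of `R`; over `ℤ`: up to sign).
[cite: Bertrand1997DualityTori, §1 (c) Corollary (p. 203)] -/
theorem associated_det_minor_dotAnnihilator (M : Submodule R (ι → R))
    (hM : ∀ (c : R) (x : ι → R), c ≠ 0 → c • x ∈ M → x ∈ M) (b : Basis (Fin r) R M)
    (b' : Basis (Fin (Fintype.card ι - r)) R (dotAnnihilator M)) (J : Set.powersetCard ι r) :
    Associated ((Matrix.of fun i ↦ (b i : ι → R)).submatrix id (ofFinEmbEquiv.symm J)).det
      ((Matrix.of fun g ↦ (b' g : ι → R)).submatrix id (ofFinEmbEquiv.symm (complCard J))).det := by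
  obtain ⟨A, F, hA, hu, husp, hw, hwsp⟩ := exists_adapted_pair M hM b
  -- `minor_J(b) ~ minor_J(u)`
  have h1 := (associated_det_submatrix_basis b hu husp (ofFinEmbEquiv.symm J)).symm
  -- `minor_{Jᶜ}(w) ~ minor_{Jᶜ}(b')`
  have h3 := associated_det_submatrix_basis b' hw hwsp (ofFinEmbEquiv.symm (complCard J))
  -- `det A · minor_{Jᶜ}(w) = ± minor_J(u)`
  have h2 := det_mul_det_submatrix_inv_rows_eq A hA F J
  have hs : (-1 : R) ^ (posSum (F : Finset ι) + posSum (J : Finset ι)) *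
      (-1 : R) ^ (posSum (F : Finset ι) + posSum (J : Finset ι)) = 1 := by
    rw [← pow_add, ← two_mul, pow_mul, neg_one_sq, one_pow]
  exact h1.trans ((associated_of_unit_mul_eq hA hs (det_mul_det_submatrix_inv_rows_eq A hA F J)).trans h3)

/-- **BERTRAND'S COROLLARY AS PRINTED (`Vol_J(M) = Vol_{J'}(M^⊥)` over `ℤ`)**: let `M` be a primitive subgroup
of rank `r` of `ℤ^ι` (`c • x ∈ M`, `c ≠ 0 ⇒ x ∈ M`; a `ℤ`-basis `b` indexed by `Fin r`), `M^⊥` its orthogonal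
complement for the standard scalar product with a `ℤ`-basis `b'` (indexed by `Fin (card ι − r)`, which exists by
`exists_basis_dotAnnihilator`), and `J` an `r`-set of coordinates with complement `J' = complCard J`. Then the
absolute value of the `J`-minor of the matrix of `b` equals the absolute value of the `J'`-minor of the matrix
of `b'`. [cite: Bertrand1997DualityTori, §1 (c) Corollary (p. 203)] -/
theorem natAbs_det_minor_eq_natAbs_det_minor_dotAnnihilator (M : Submodule ℤ (ι → ℤ))
    (hM : ∀ (c : ℤ) (x : ι → ℤ), c ≠ 0 → c • x ∈ M → x ∈ M) (b : Basis (Fin r) ℤ M)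
    (b' : Basis (Fin (Fintype.card ι - r)) ℤ (dotAnnihilator M)) (J : Set.powersetCard ι r) :
    ((Matrix.of fun i ↦ (b i : ι → ℤ)).submatrix id (ofFinEmbEquiv.symm J)).det.natAbs =
      ((Matrix.of fun g ↦ (b' g : ι → ℤ)).submatrix id (ofFinEmbEquiv.symm (complCard J))).det.natAbs :=
  Int.natAbs_eq_iff_associated.2 (associated_det_minor_dotAnnihilator M hM b b' J)

end Ordered

end Primitive

end Literature.LinearAlgebra.Matrix
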